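import Summits.FinalStateConjecture.FinalStateConjecture.Theses.BartnikGapSettling
import Summits.FinalStateConjecture.FinalStateConjecture.Theorems.GapExhaustion.Negative.GapExhaustionFalseOfFarWildBlackHole
import Literature.Geometry.Lorentzian.RedShiftedHorizon
import Literature.Geometry.Lorentzian.KillingHorizonShadowAlong
import Literature.Geometry.Lorentzian.SpacetimeLocalConvergence
import Literature.Geometry.Lorentzian.Geodesic
import Literature.Geometry.Lorentzian.Einstein
import Literature.Geometry.Lorentzian.KerrSchild
import Literature.Geometry.Lorentzian.KerrNullRadialPotential
import Literature.Geometry.Lorentzian.CoordScalarCurvatureEvolution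
import Summits.FinalStateConjecture.FinalStateConjecture.Theorems.BartnikGapSettlingGapExhaustionHessMarginStable
import Summits.FinalStateConjecture.FinalStateConjecture.Theorems.BartnikGapSettlingGapExhaustionCylindersBendInwardOf
import Summits.FinalStateConjecture.FinalStateConjecture.Theorems.BartnikGapSettlingGapExhaustionCylindersExactMargin
import Mathlib.Analysis.SpecialFunctions.Trigonometric.Inverse
import Mathlib.Analysis.SpecialFunctions.Exp
import Mathlib.Analysis.Calculus.IteratedDeriv.Defs

/-!
# Line `eternal-redshift-rigidity` — crux `GapExhaustion` (stmt-FinalStateConjecture-10808)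

Crux-plan workfile (planner-cruxplan-stmt-FinalStateConjecture-10808-eternal-redshift-rig-0,
2026-08-16) for idea `Ideas/eternal-redshift-rigidity.md` (triage r1-1/r1-2/r1-3: pass, with the
mandatory re-typing "B1 + non-expansion + two-sided bounds"). Companion card:
`Lines/eternal-redshift-rigidity.md`.

## STATUS: NO COMPOSITION TO THE FILED DECL (`no-skeleton` on `GapExhaustion` as filed)

There is deliberately NO theorem `GapExhaustion_of : stub₁ → … → GapExhaustion` in this file.
The FILED decl `Theses.BartnikGapSettling.GapExhaustion` is decided by far-field bookkeeping,
not by its intended content: it is FALSE modulo the construction hypothesis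
`FarWildBlackHoleExists` (`GapExhaustion_false_of_farWildBlackHoleExists`, p108531, imported
above so that this file is checked against it) and TRUE only vacuously modulo junk collars
(`GapExhaustion_of_junkCollars`, p116015); the previous line `Sketch` died at its lead stub for
the same reason (p115847, `Lines/Sketch-dead-c5.md`). Consequently EVERY stub set composing to
the filed text contains a stub that is false on the (W)+(F)+(C) developments of p108531 — a
composition would be a costume. See the crux `NOTES.md` STATUS block and `AUDIT-c4.md` §5.

What this file DOES contain is the typed, elaborating stub set of the line's NEAR-HORIZON LEG,
stated over existing Literature declarations only (no route decl, no restated-crux decl), so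
that it survives the pending tenure restatement of 10808 (`RESTATED_c4.lean`, `GapExhaustionC4`,
conjunct (iii) "late `δ`-collars per hole") unchanged:

* §1 `eq_div_of_bounded_eternal_redshift_ode` — B0, the scalar frozen-jet lemma, PROVED.
* §2 vocabulary: the eternal rest-frame star region `eternalRegion M a = {M < r < 4M}` (all
  `t*`), its far shell, the causal exterior `I⁻(far shell)` and horizon `∂I⁻(far shell) ∩ chart`
  of an eternal chart, the ETERNAL TWO-SIDED BOUNDED chart block `IsEternalBoundedChart`
  (answers triage: `chartMetricCk ≤ Λ` alone lets `Φ^* g` degenerate), the NON-EXPANDING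
  red-shifted horizon `IsNonExpandingRedShiftedHorizon` (= the body of
  `LorentzianMetric.HasSurfaceGravityGe` + the null second fundamental form of the SAME generator
  field is skew on `L^⊥`; answers triage: B1 without non-expansion is false on Kerr + one
  absorbed packet), the inward-bending (strong null pseudo-convexity) of the coordinate
  cylinders `InwardBendingCylinders` (rev c6: Ionescu–Klainerman Hessian form).
* §3 three registered-shape stubs `stub_horizonIgnition` (B1′, the load-bearing new statement),
  `stub_sandwichExtension` (S5, conditional non-perturbative form: IK Thm 1.2 swept through a
  uniformly pseudo-convex eternal family), `stub_kerrCylindersBendInward` (photon-shell's inner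
  claim + `C²`-openness), and the kernel-checked composition
  `eternalCollarKilling_of : HorizonIgnition → SandwichExtension → KerrCylindersBendInward →
  EternalCollarKilling` (the line's near-horizon deliverable, NOT the crux).

Nothing here is asserted to be true; `sorry` occurs exactly in the `stub_*` theorems still open.

## rev c6 (line lead c6, 2026-08-16): `stub_kerrCylindersBendInward` reshaped and (being) PROVED

* `InwardBendingCylinders` is restated in Ionescu–Klainerman's own form (arXiv:1108.3575 /
  JAMS 26 (2013), Def. 1.1): the coordinate Hessian `Hess r(w,w)` of the Kerr–Schild radius with
  respect to the pulled-back components `𝓢.metricInCoords Φ` (`MetricCoord.hessAt`) is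
  `≤ −μ‖w‖²` on every vector null for those components and tangent to the cylinder, at every
  band point. The rev-1 geodesic phrasing (`r̈(0) ≤ −μ‖ż(0)‖²` along tangential null geodesics
  `Φ ∘ ζ`) is its reading through `OpensChartGeodesicODE.hasDerivAt_of_isGeodesicOn` +
  `MetricCoord.hessAt` and is not what S5 (`SandwichExtension`, IK Thm 1.2) consumes.
* `Kerr.rPhotonInner M a` (BPT (2.18), `2M(1 + cos(⅔ arccos(−|a|/M)))`) is replaced by the tree's
  `Kerr.photonOrbitRadius M (−|a|)` (`= 4M cos²(⅓ arccos(−|a|/M))`, the same number), over which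
  line lead a2's apocentre theorem and the whole pseudo-convexity chain are stated.
* `KerrCylindersBendInward` (now without the idle `HasLeviCivita` binder) = (B) exact-Kerr
  uniform margin `stub_kerrCylindersExactMargin` + (C) generic `C¹`-jet stability
  `stub_hessMarginStable` (p123608) + (E) glue `stub_kerrCylindersBendInward_of` (p123675), all
  registered on the crux item; (B) rests on the Literature chain `KerrRadiusPseudoconvexity` →
  `KerrRadiusHessianChart` → `KerrRadiusHessianIdentity` → `KerrRadiusPseudoconvexityKS`
  (p123048/p123703/p123954/p124217: `Kerr.hessAt_radius_neg` — every cylinder `{r = c}`,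
  `r₊ < c < r_ph⁺`, of exact sub-extremal Kerr is strongly null pseudo-convex inward, axis
  included; and `Kerr.hessAt_radius_pos` outward beyond `r_ph⁻`).
-/

noncomputable section

-- D-0017: single-problem summit, `Summit.<S>.<S>.…` by design (cf. lakefile `weak.linter.dupNamespace`).
set_option linter.dupNamespace false

namespace Summit.FinalStateConjecture.FinalStateConjecture.Cruxes.GapExhaustion.EternalRedshiftRigidity

open Literature.Geometry.Lorentzian
open Bundle Set Filter Manifold
open scoped Manifold ContDiff Topology ENNReal

/-! ## §0 The filed target is dead (pointer, checked against the import) -/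

/-- Pointer to the negative lemma that kills every composition to the filed decl (p108531):
`FarWildBlackHoleExists → ¬ GapExhaustion`. Re-exported by name so that this workfile fails to
elaborate if the negative side is ever renamed. [folklore] -/
theorem filedTarget_false_of_farWildBlackHoleExists :
    Theorems.GapExhaustion.Negative.FarWildBlackHoleExists →
      ¬ Theses.BartnikGapSettling.GapExhaustion :=
  Theorems.GapExhaustion.Negative.GapExhaustion_false_of_farWildBlackHoleExists

/-! ## §1 B0 — the scalar frozen-jet lemma (PROVED) -/

/-- **B0 (eternal red-shift ODE Liouville lemma).** A solution of `X' = c − κ X` (`κ > 0`)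
defined and BOUNDED on all of `ℝ` is the constant `c / κ`: conjugating by `e^{κ v}` makes
`(X − c/κ) e^{κ v}` constant, and boundedness as `v → −∞` kills the homogeneous (blue-shifted)
mode. This is the one-jet, one-generator caricature of the frozen-jet step of the line
(transversal jets at a non-expanding horizon obey `∂_v X_j = −jκ X_j + F_j(X_{<j})`).
[folklore] -/
theorem eq_div_of_bounded_eternal_redshift_ode (κ c : ℝ) (hκ : 0 < κ) (X : ℝ → ℝ)
    (hX : ∀ v, HasDerivAt X (c - κ * X v) v) (hb : ∃ B, ∀ v, |X v| ≤ B) :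
    ∀ v, X v = c / κ := by
  obtain ⟨B, hB⟩ := hb
  -- the conjugated quantity `Y v = (X v - c/κ) * exp (κ v)` has zero derivative
  set Y : ℝ → ℝ := fun v => (X v - c / κ) * Real.exp (κ * v) with hY
  have hYd : ∀ v, HasDerivAt Y 0 v := by
    intro v
    have h1 : HasDerivAt (fun v => X v - c / κ) (c - κ * X v) v := (hX v).sub_const _
    have h2 : HasDerivAt (fun v => Real.exp (κ * v)) (Real.exp (κ * v) * (κ * 1)) v :=
      ((hasDerivAt_id v).const_mul κ).exp
    have h3 := h1.mul h2
    have hzero : (c - κ * X v) * Real.exp (κ * v) + (X v - c / κ) * (Real.exp (κ * v) * (κ * 1))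
        = 0 := by
      field_simp
      ring
    rw [hzero] at h3
    exact h3
  have hYconst : ∀ v, Y v = Y 0 := by
    intro v
    have hdiff : Differentiable ℝ Y := fun v => (hYd v).differentiableAt
    have hderiv : ∀ v, deriv Y v = 0 := fun v => (hYd v).deriv
    exact is_const_of_deriv_eq_zero hdiff hderiv v 0
  -- hence `X v - c/κ = d * exp (-(κ v))` with `d = X 0 - c/κ`
  set d : ℝ := X 0 - c / κ with hd
  have hkey : ∀ v, X v - c / κ = d * Real.exp (-(κ * v)) := by
    intro v
    have h := hYconst v
    simp only [hY, mul_zero, Real.exp_zero, mul_one] at h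
    have hpos : 0 < Real.exp (κ * v) := Real.exp_pos _
    rw [Real.exp_neg, eq_mul_inv_iff_mul_eq₀ hpos.ne', hd]
    exact h
  -- boundedness as `v → -∞` forces `d = 0`
  have hd0 : d = 0 := by
    by_contra hne
    have hdpos : 0 < |d| := abs_pos.mpr hne
    set B' : ℝ := B + |c / κ| with hB'
    have hB'nn : 0 ≤ B' := by
      have := (abs_nonneg (X 0)).trans (hB 0)
      positivity
    -- choose `v` with `exp (-(κ v)) = exp s`, `s = (B' + 1)/|d|`
    set s : ℝ := (B' + 1) / |d| with hs
    have hspos : 0 < s := by positivity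
    set v : ℝ := -(s / κ) with hv
    have hexp : Real.exp (-(κ * v)) = Real.exp s := by
      rw [hv]
      congr 1
      field_simp
    have hbound : |X v - c / κ| ≤ B' := by
      calc |X v - c / κ| ≤ |X v| + |c / κ| := abs_sub _ _
        _ ≤ B + |c / κ| := by linarith [hB v]
    rw [hkey v, hexp, abs_mul, abs_of_pos (Real.exp_pos s)] at hbound
    have hlow : s + 1 ≤ Real.exp s := Real.add_one_le_exp s
    have : |d| * (s + 1) ≤ B' := (mul_le_mul_of_nonneg_left hlow hdpos.le).trans hbound
    have hds : |d| * s = B' + 1 := by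
      rw [hs]
      field_simp
    nlinarith [hds, this, hdpos]
  intro v
  have h := hkey v
  rw [hd0, zero_mul, sub_eq_zero] at h
  exact h

/-! ## §2 Vocabulary of the near-horizon leg -/

/-- The **eternal rest-frame star region** `{z ∈ E4 | M < r(a, z) < 4M}` of Kerr–Schild
coordinate space — ALL Kerr-star times `z⁰ ∈ ℝ` (the collar `{M < r ≤ 3M}` of the crux plus one
far layer `{3M < r < 4M}`). [folklore] -/
def eternalRegion (M a : ℝ) : Set E4 :=
  {z | M < Kerr.radius a z ∧ Kerr.radius a z < 4 * M}

/-- The **far shell** `{3M < r < 4M}` (all times) of the eternal region: the stand-in for the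
asymptotic end when the causal horizon of an eternal chart is formed. [folklore] -/
def farShell (M a : ℝ) : Set E4 :=
  {z | 3 * M < Kerr.radius a z ∧ Kerr.radius a z < 4 * M}

theorem farShell_subset_eternalRegion {M a : ℝ} (hM : 0 < M) :
    farShell M a ⊆ eternalRegion M a :=
  fun _ hz => ⟨by linarith [hz.1], hz.2⟩

section Spacetime

variable (𝓢 : Spacetime.{0} 4)

/-- The **causal exterior of an eternal chart** `Φ : E4 → 𝓢`: the chronological past, in `𝓢`,
of the image of the far shell, `I⁻(Φ '' {3M < r < 4M})`. For the Kerr star chart this is the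
charted part of the domain of outer communications. [folklore] -/
def chartExterior (M a : ℝ) (Φ : E4 → 𝓢.carrier) : Set 𝓢.carrier :=
  𝓢.metric.chronologicalPast 𝓢.timeOrientation (Φ '' farShell M a)

/-- The **horizon of an eternal chart**: `∂ I⁻(far shell) ∩ Φ '' (eternal region)` — the
boundary of the causal exterior inside the charted region (for the Kerr star chart: the future
event horizon `{r = r₊}`, all `v ∈ ℝ`). [folklore] -/
def chartHorizon (M a : ℝ) (Φ : E4 → 𝓢.carrier) : Set 𝓢.carrier :=
  frontier (chartExterior 𝓢 M a Φ) ∩ Φ '' eternalRegion M a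

/-- **Eternal two-sided bounded star chart at order `k` with constant `Λ`** (the hypothesis
class of the lever; compare `Spacetime.RedShiftedCollarWitness` (1),(2),(4),(5) with `τ₁ = −∞`
and the collar widened to `{M < r < 4M}`): `Φ` is smooth on the eternal region and an open
embedding of it; the components `Φ^* g` (`Spacetime.metricInCoords`) have `Cᵏ` sup norm `≤ Λ`
over the WHOLE eternal region (all `t* ∈ ℝ`: the bound is two-sided in time); the coordinate
slices `{z⁰ = const}` are uniformly spacelike, `Φ^*g(v,v) ≥ Λ⁻¹‖v‖²` for `v⁰ = 0`, and at
every point some direction in the unit ball is uniformly timelike, `Φ^*g(w,w) ≤ −Λ⁻¹` — so the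
pulled-back form is uniformly non-degenerate and its inverse is bounded in `Cᵏ` by a constant
depending on `Λ` only (two-sided control, as demanded by TRIAGE-r1-1/r1-3). [folklore] -/
def IsEternalBoundedChart (k : ℕ) (Λ M a : ℝ) (Φ : E4 → 𝓢.carrier) : Prop :=
  ContMDiffOn 𝓘(ℝ, E4) (𝓡 4) ∞ Φ (eternalRegion M a) ∧
  Topology.IsOpenEmbedding ((eternalRegion M a).restrict Φ) ∧
  supCkENorm (eternalRegion M a) k (𝓢.metricInCoords Φ) ≤ ENNReal.ofReal Λ ∧
  ∀ z ∈ eternalRegion M a,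
    (∀ v : E4, v 0 = 0 → Λ⁻¹ * ‖v‖ ^ 2 ≤ 𝓢.metricInCoords Φ z v v) ∧
    ∃ w : E4, ‖w‖ ≤ 1 ∧ 𝓢.metricInCoords Φ z w w ≤ -Λ⁻¹

variable [𝓢.metric.HasLeviCivita]

/-- **Non-expanding red-shifted horizon** `𝓗` with respect to the clock `t`, surface gravity
`≥ κ₀` (B1′'s horizon clause). The body of `LorentzianMetric.HasSurfaceGravityGe` — a generator
field `L`, smooth near `𝓗`, future null, clock-normalised `dt(L) = 1`, pregeodesic
`∇_L L = κ L` with `κ ≥ κ₀`, `𝓗` forward-invariant under its flow — PLUS, for the SAME `L`,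
NON-EXPANSION: the null second fundamental form `B(Y, Z) = g(∇_Y L, Z)` is skew on
`L^⊥ = T𝓗` at every point of `𝓗` (`θ = 0`, `σ̂ = 0`; in vacuum `θ ≡ 0` alone gives `σ̂ ≡ 0` by
Raychaudhuri). What ω-limits inherit from the area law + bounded final area; its omission made
the card's B1 false (Kerr + one absorbed packet, TRIAGE-r1-1/2/3). [folklore] -/
def IsNonExpandingRedShiftedHorizon (𝓗 : Set 𝓢.carrier) (t : 𝓢.carrier → ℝ) (κ₀ : ℝ) :
    Prop :=
  ∃ (L : Π x : 𝓢.carrier, TangentSpace (𝓡 4) x) (κ : 𝓢.carrier → ℝ),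
    (∃ 𝒩 : Set 𝓢.carrier, IsOpen 𝒩 ∧ 𝓗 ⊆ 𝒩 ∧
      ContMDiffOn (𝓡 4) ((𝓡 4).prod 𝓘(ℝ, E4)) ∞
        (fun x => (TotalSpace.mk' E4 x (L x) : TangentBundle (𝓡 4) 𝓢.carrier)) 𝒩) ∧
    (∀ p ∈ 𝓗, 𝓢.metric.IsNull (L p) ∧ 𝓢.timeOrientation.IsFutureDirected (L p) ∧
      mvfderiv (𝓡 4) t p (L p) = 1 ∧ 𝓢.metric.leviCivita L p (L p) = κ p • L p ∧ κ₀ ≤ κ p) ∧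
    (∀ (γ : ℝ → 𝓢.carrier) (a b : ℝ), a ≤ b → IsMIntegralCurveOn γ L (Icc a b) →
      γ a ∈ 𝓗 → γ b ∈ 𝓗) ∧
    ∀ p ∈ 𝓗, ∀ Y Z : TangentSpace (𝓡 4) p,
      𝓢.metric.val p (L p) Y = 0 → 𝓢.metric.val p (L p) Z = 0 →
        𝓢.metric.val p (𝓢.metric.leviCivita L p Y) Z +
          𝓢.metric.val p Y (𝓢.metric.leviCivita L p Z) = 0

omit [𝓢.metric.HasLeviCivita] in
/-- Projection: a non-expanding red-shifted horizon has surface gravity `≥ κ₀` in the tree's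
sense (`LorentzianMetric.HasSurfaceGravityGe`, RedShiftedHorizon.lean). [folklore] -/
theorem IsNonExpandingRedShiftedHorizon.hasSurfaceGravityGe [𝓢.metric.HasLeviCivita]
    {𝓗 : Set 𝓢.carrier} {t : 𝓢.carrier → ℝ} {κ₀ : ℝ}
    (h : IsNonExpandingRedShiftedHorizon 𝓢 𝓗 t κ₀) :
    𝓢.metric.HasSurfaceGravityGe 𝓢.timeOrientation 𝓗 t κ₀ := by
  obtain ⟨L, κ, hreg, hpt, hinv, -⟩ := h
  exact ⟨L, κ, hreg, hpt, hinv⟩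

/-- **Inward-bending coordinate cylinders with margin `μ` on `[r_lo, r_e]`** — strong null
pseudo-convexity of `{r = c}`, `c ∈ [r_lo, r_e]`, with respect to the known side `{r < c}`, in
Ionescu–Klainerman's form (arXiv:1108.3575 / JAMS 26 (2013), Def. 1.1; rev c6): at every point `z`
of the eternal region with `r_lo ≤ r(z) ≤ r_e`, every vector `w` that is NULL for the pulled-back
components `Φ^* g = 𝓢.metricInCoords Φ` and TANGENT to the cylinder (`dr_z(w) = 0`) has
coordinate Hessian `Hess_{Φ^*g} r_z(w, w) ≤ −μ‖w‖²` (`MetricCoord.hessAt`: `D²r(w,w) − dr(Γ(w,w))`,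
O'Neill 1983, Ch. 3, Lemma 3.49). Along a tangential null geodesic this is `r̈ ≤ −μ‖ż‖²`.
[cite: IonescuKlainerman2012, Def. 1.1] -/
def InwardBendingCylinders (M a r_lo r_e μ : ℝ) (Φ : E4 → 𝓢.carrier) : Prop :=
  ∀ z ∈ eternalRegion M a, ∀ w : E4, r_lo ≤ Kerr.radius a z → Kerr.radius a z ≤ r_e →
    𝓢.metricInCoords Φ z w w = 0 → fderiv ℝ (Kerr.radius a) z w = 0 →
    MetricCoord.hessAt (𝓢.metricInCoords Φ) (Kerr.radius a) z w w ≤ -μ * ‖w‖ ^ 2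

end Spacetime

/-! ## §3 The stubs of the near-horizon leg and their composition -/

/-- **Stub B1′ — HORIZON IGNITION (load-bearing, new).** For every label `(M, a)` with
`|a| < M`, constants `Λ, κ₀ > 0` and order `k ≥ 3` there is a collar scale `η > 0` such that:
in every smooth time-oriented spacetime carrying an ETERNAL two-sided `(Λ, k)`-bounded star
chart `Φ` on `{M < r < 4M} × ℝ`, Ricci-flat, whose chart horizon
`𝓗 = ∂I⁻(far shell) ∩ chart` is a NON-EXPANDING horizon of surface gravity `≥ κ₀` with respect
to the chart clock `t* = z⁰`, there is a Killing field `T` on an open set `V` containing `𝓗`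
and the `η`-thickening of `𝓗` in chart coordinates, with `T ≠ 0` on `𝓗`. Mechanism: frozen
transversal jets (`∂_v X_j = −jκX_j + F_j(X_{<j})`, B0 generator by generator; two-sided
boundedness toward `v → −∞` kills every homogeneous blue-shifted mode) + slaving of the free
ingoing-cone datum near `𝓗`; Petersen–Rácz compact-horizon rigidity with eternity + two-sided
bounds in place of compactness of the generators. Honours `IonescuKlainermanNonExtension`
(its Thm 1.3 patches are STATIONARY: `T` exists; only the axial field fails) and is void at
`κ₀ = 0` (`AretakisInstability`). The uniformity of `η` in the class is part of the claim. -/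
def HorizonIgnition : Prop :=
  ∀ (M a Λ κ₀ : ℝ) (k : ℕ), 0 < M → |a| < M → 0 < Λ → 0 < κ₀ → 3 ≤ k →
    ∃ η : ℝ, 0 < η ∧
    ∀ (𝓢 : Spacetime.{0} 4) [𝓢.metric.HasLeviCivita] (Φ : E4 → 𝓢.carrier)
      (t : 𝓢.carrier → ℝ),
      IsEternalBoundedChart 𝓢 k Λ M a Φ →
      (∀ z ∈ eternalRegion M a, t (Φ z) = z 0) →
      𝓢.metric.toPseudoRiemannianMetric.IsRicciFlat →
      IsNonExpandingRedShiftedHorizon 𝓢 (chartHorizon 𝓢 M a Φ) t κ₀ →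
      ∃ (T : Π x : 𝓢.carrier, TangentSpace (𝓡 4) x) (V : Set 𝓢.carrier),
        IsOpen V ∧ chartHorizon 𝓢 M a Φ ⊆ V ∧
        (∀ z ∈ eternalRegion M a, ∀ z' ∈ eternalRegion M a,
          Φ z' ∈ chartHorizon 𝓢 M a Φ → dist z z' < η → Φ z ∈ V) ∧
        𝓢.metric.toPseudoRiemannianMetric.IsKillingFieldOn T V ∧
        ∀ p ∈ chartHorizon 𝓢 M a Φ, T p ≠ 0

/-- **Stub S5 — SANDWICH EXTENSION (conditional, non-perturbative form).** In an eternal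
two-sided `(Λ, k)`-bounded Ricci-flat star chart, a Killing field `T` on an open `V` containing
the `η`-thickening of the chart horizon AND the exterior layer `{r ≤ r_lo}` extends to a Killing
field on the exterior collar `{r < r_e}` provided the coordinate cylinders `{r = c}`,
`c ∈ [r_lo, r_e]`, are inward-bending with a uniform margin `μ` (strong null pseudo-convexity
w.r.t. the known side). Mechanism: Ionescu–Klainerman arXiv:1108.3575 Thm 1.2 (local extension
of Killing fields across strongly pseudo-convex hypersurfaces in Ricci-flat manifolds) swept
outward in `c`, the eternal non-compactness in `t*` being paid for by the UNIFORM bounds `Λ`, `μ`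
(uniform Carleman constants) — the card's "ODE transport along ingoing cones" is the
characteristic shadow of the same continuation. Respects `SbierskiTrappingObstruction`: no claim
at or beyond a cylinder carrying tangential trapped null geodesics (`μ > 0` excludes them). -/
def SandwichExtension : Prop :=
  ∀ (M a Λ r_lo r_e η μ : ℝ) (k : ℕ), 0 < M → |a| < M → 0 < Λ → 0 < η → 0 < μ →
    M < r_lo → r_lo < r_e → r_e < 4 * M → 3 ≤ k →
    ∀ (𝓢 : Spacetime.{0} 4) [𝓢.metric.HasLeviCivita] (Φ : E4 → 𝓢.carrier)
      (T : Π x : 𝓢.carrier, TangentSpace (𝓡 4) x) (V : Set 𝓢.carrier),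
      IsEternalBoundedChart 𝓢 k Λ M a Φ →
      𝓢.metric.toPseudoRiemannianMetric.IsRicciFlat →
      IsOpen V →
      (∀ z ∈ eternalRegion M a, ∀ z' ∈ eternalRegion M a,
        Φ z' ∈ chartHorizon 𝓢 M a Φ → dist z z' < η → Φ z ∈ V) →
      𝓢.metric.toPseudoRiemannianMetric.IsKillingFieldOn T V →
      (∀ z ∈ eternalRegion M a, Kerr.radius a z ≤ r_lo → Φ z ∈ chartExterior 𝓢 M a Φ →
        Φ z ∈ V) →
      InwardBendingCylinders 𝓢 M a r_lo r_e μ Φ →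
      ∃ T' : Π x : 𝓢.carrier, TangentSpace (𝓡 4) x,
        𝓢.metric.toPseudoRiemannianMetric.IsKillingFieldOn T'
          (V ∪ (Φ '' {z ∈ eternalRegion M a | Kerr.radius a z < r_e} ∩
            chartExterior 𝓢 M a Φ)) ∧
        ∀ p ∈ V, T' p = T p

/-- **Stub P — KERR CYLINDERS BEND INWARD BELOW THE INNER PHOTON ORBIT, STABLY** (shared with
line photon-shell-pseudoconvexity, inner claim; rev c6 form). For `r₊ < r_lo < r_e < r_ph⁺(a) =
Kerr.photonOrbitRadius M (−|a|)` there are `δ, μ > 0` such that every smooth chart `Φ` of the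
eternal region, an open embedding of it, whose pulled-back components are `δ`-close in `C²` to the
Kerr–Schild form `Kerr.bilin M a` on the eternal band `{r_lo ≤ r ≤ r_e}`, has inward-bending
cylinders with margin `μ` there. PROOF ROUTE (rev c6, registered sub-stubs B/C/E of the crux item):
exact Kerr has `Hess r(w,w) < 0` on every non-zero null tangent vector at every band point
(`Kerr.hessAt_radius_neg`, Carter-separation identities + the apocentre theorem, axis by
continuity), hence a uniform margin on the compact normalised constraint set of a time slice,
all times by stationarity (B); a `C¹`-jet perturbation keeps half the margin (C); the pulled-back
components are `C^∞` on the open region and pointwise `δ`-close with first derivatives (E).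
[cite: IonescuKlainerman2012, Def. 1.1] -/
def KerrCylindersBendInward : Prop :=
  ∀ (M a r_lo r_e : ℝ), 0 < M → |a| < M → Kerr.rPlus M a < r_lo → r_lo < r_e →
    r_e < Kerr.photonOrbitRadius M (-|a|) →
    ∃ (δ μ : ℝ), 0 < δ ∧ 0 < μ ∧
    ∀ (𝓢 : Spacetime.{0} 4) (Φ : E4 → 𝓢.carrier),
      ContMDiffOn 𝓘(ℝ, E4) (𝓡 4) ∞ Φ (eternalRegion M a) →
      Topology.IsOpenEmbedding ((eternalRegion M a).restrict Φ) →
      supCkENorm {z ∈ eternalRegion M a | r_lo ≤ Kerr.radius a z ∧ Kerr.radius a z ≤ r_e} 2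
          (fun z => 𝓢.metricInCoords Φ z - Kerr.bilin M a z) ≤ ENNReal.ofReal δ →
      InwardBendingCylinders 𝓢 M a r_lo r_e μ Φ

/-- **The near-horizon deliverable of the line (perturbative closure; NOT the crux).** For a
label `(M, a)`, `|a| < M`, constants `Λ, κ₀ > 0`, order `k ≥ 3` there is a collar scale `η > 0`,
and then for every band `r₊ < r_lo < r_e < min (r_ph⁺(a), 4M)` (`r_ph⁺ = Kerr.photonOrbitRadius M (−|a|)`) with `M < r_lo` a closeness
`δ > 0`, such that: an eternal two-sided `(Λ,k)`-bounded Ricci-flat star chart whose chart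
horizon is a non-expanding horizon of surface gravity `≥ κ₀` for the chart clock, which is
`δ`-close in `C²` to Kerr(`M`,`a`) on the band and whose sub-`r_lo` exterior layer lies within
coordinate distance `η` of the horizon, carries a Killing field on the exterior collar
`{r < r_e} ∩ I⁻(far shell)`, non-vanishing on the horizon. In the line this is applied to
late-time ω-limits of the crux's Λ-bounded horizon-penetrating leaves (extraction and read-back
stubs of the card, not typed here); Kerr-ness of the limit is the shared no-hair residual. -/
def EternalCollarKilling : Prop :=
  ∀ (M a Λ κ₀ : ℝ) (k : ℕ), 0 < M → |a| < M → 0 < Λ → 0 < κ₀ → 3 ≤ k →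
    ∃ η : ℝ, 0 < η ∧
    ∀ (r_lo r_e : ℝ), Kerr.rPlus M a < r_lo → M < r_lo → r_lo < r_e →
      r_e < Kerr.photonOrbitRadius M (-|a|) → r_e < 4 * M →
      ∃ δ : ℝ, 0 < δ ∧
      ∀ (𝓢 : Spacetime.{0} 4) [𝓢.metric.HasLeviCivita] (Φ : E4 → 𝓢.carrier)
        (t : 𝓢.carrier → ℝ),
        IsEternalBoundedChart 𝓢 k Λ M a Φ →
        (∀ z ∈ eternalRegion M a, t (Φ z) = z 0) →
        𝓢.metric.toPseudoRiemannianMetric.IsRicciFlat →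
        IsNonExpandingRedShiftedHorizon 𝓢 (chartHorizon 𝓢 M a Φ) t κ₀ →
        supCkENorm {z ∈ eternalRegion M a | r_lo ≤ Kerr.radius a z ∧ Kerr.radius a z ≤ r_e} 2
            (fun z => 𝓢.metricInCoords Φ z - Kerr.bilin M a z) ≤ ENNReal.ofReal δ →
        (∀ z ∈ eternalRegion M a, Kerr.radius a z ≤ r_lo → Φ z ∈ chartExterior 𝓢 M a Φ →
          ∃ z' ∈ eternalRegion M a, Φ z' ∈ chartHorizon 𝓢 M a Φ ∧ dist z z' < η) →
        ∃ T : Π x : 𝓢.carrier, TangentSpace (𝓡 4) x,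
          𝓢.metric.toPseudoRiemannianMetric.IsKillingFieldOn T
            (Φ '' {z ∈ eternalRegion M a | Kerr.radius a z < r_e} ∩ chartExterior 𝓢 M a Φ) ∧
          ∀ p ∈ chartHorizon 𝓢 M a Φ, T p ≠ 0

theorem stub_horizonIgnition : HorizonIgnition := by
  sorry

theorem stub_sandwichExtension : SandwichExtension := by
  sorry

/-- **Stub P is PROVED (rev c6)**: the composition of the registered sub-stubs (B) exact-Kerr
uniform margin, (C) `C¹`-jet stability, (E) glue — `Theorems.stub_kerrCylindersBendInward_of
Theorems.stub_kerrCylindersExactMargin Theorems.stub_hessMarginStable` has exactly the type of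
`KerrCylindersBendInward` after unfolding `eternalRegion` and `InwardBendingCylinders`. -/
theorem stub_kerrCylindersBendInward : KerrCylindersBendInward :=
  Theorems.stub_kerrCylindersBendInward_of Theorems.stub_kerrCylindersExactMargin
    Theorems.stub_hessMarginStable

/-- Restriction of a Killing field on `U` to a subset `U' ⊆ U` (O'Neill 1983, Ch. 9, Def. 22).
[folklore] -/
theorem isKillingFieldOn_mono {𝓢 : Spacetime.{0} 4} [𝓢.metric.HasLeviCivita]
    {K : Π x : 𝓢.carrier, TangentSpace (𝓡 4) x} {U U' : Set 𝓢.carrier}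
    (h : 𝓢.metric.toPseudoRiemannianMetric.IsKillingFieldOn K U) (hU : U' ⊆ U) :
    𝓢.metric.toPseudoRiemannianMetric.IsKillingFieldOn K U' :=
  ⟨h.1.mono hU, fun x hx Y₀ Z₀ => h.2 x (hU hx) Y₀ Z₀⟩

/-- **Composition of the near-horizon leg (kernel-checked, sorry-free):** horizon ignition,
the conditional sandwich extension and the perturbative inward bending of Kerr's cylinders give
the line's near-horizon deliverable. This is NOT a composition to the crux `GapExhaustion`
(impossible for the filed text, §0); it certifies that the three stubs are cut so as to glue.
[folklore] -/
theorem eternalCollarKilling_of :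
    HorizonIgnition → SandwichExtension → KerrCylindersBendInward → EternalCollarKilling := by
  intro hI hS hK M a Λ κ₀ k hM ha hΛ hκ₀ hk
  obtain ⟨η, hη, HI⟩ := hI M a Λ κ₀ k hM ha hΛ hκ₀ hk
  refine ⟨η, hη, fun r_lo r_e hplus hMlo hloe hph h4 => ?_⟩
  obtain ⟨δ, μ, hδ, hμ, HK⟩ := hK M a r_lo r_e hM ha hplus hloe hph
  refine ⟨δ, hδ, fun 𝓢 _ Φ t hch ht hvac hneh hclose hlayer => ?_⟩
  obtain ⟨T, V, hV, h𝓗V, hthick, hKill, hne⟩ := HI 𝓢 Φ t hch ht hvac hneh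
  have hpc : InwardBendingCylinders 𝓢 M a r_lo r_e μ Φ := HK 𝓢 Φ hch.1 hch.2.1 hclose
  have hlayer' : ∀ z ∈ eternalRegion M a, Kerr.radius a z ≤ r_lo →
      Φ z ∈ chartExterior 𝓢 M a Φ → Φ z ∈ V := by
    intro z hz hr hx
    obtain ⟨z', hz', h1, h2⟩ := hlayer z hz hr hx
    exact hthick z hz z' hz' h1 h2
  obtain ⟨T', hT', hTT'⟩ :=
    hS M a Λ r_lo r_e η μ k hM ha hΛ hη hμ hMlo hloe h4 hk 𝓢 Φ T V hch hvac hV hthick hKill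
      hlayer' hpc
  refine ⟨T', isKillingFieldOn_mono hT' subset_union_right, fun p hp => ?_⟩
  rw [hTT' p (h𝓗V hp)]
  exact hne p hp

end Summit.FinalStateConjecture.FinalStateConjecture.Cruxes.GapExhaustion.EternalRedshiftRigidity

end
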